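import Mathlib
import Summits.ResolutionOfSingularities.ResolutionOfSingularities.Theorems.WeightedInvariantLocalWeightedDropTOT2ChartWeierstrassPair
import Summits.ResolutionOfSingularities.ResolutionOfSingularities.Theorems.WeightedInvariantLocalWeightedDropTOT2ChartMonomialMap

/-!
# TOT2-LINE (P3) brick B4, kernel part 3: SYMBOLIC POWERS DESCEND ALONG THE MONOMIAL CHART MAPS

Sub-problem `ResolutionOfSingularities`, ENGINE crux `stmt-ResolutionOfSingularities-8899` (`LocalWeightedDrop`), skeleton v35
(2e806da509994632), registered stub `stub_conflictBudget` (P3), bricks B4-1 … B4-4 of `L/res-L1-w43-stub-2/g6/P3_split_v1.lean`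
(downward transport of the top-locus primes).  [OURS · L1 W4.3 · chain w43 · res-L1-w43-lead-1 g6; def-free; the blow-up/excellence
content is replaced by Weierstrass division; nothing here is a statement of any manuscript; AI-produced, gate-checked, weaker than
expert review.]

SETTING.  `Φ = Φ_ε : (x,v,w) ↦ (x, x^{ε₁}v, x^{ε₂}w)` on `R₃ = k⟦x,v,w⟧`; a prime `P′ ∌ x` upstairs containing two WEIERSTRASS ELEMENTS
`W_v = v^α + Σ_{j<α} a_j(x) x^{e_j} v^j`, `W_w = w^β + Σ_{j<β} b_j(x) x^{f_j} w^j` (`a_j(0) = b_j(0) = 0`); their Φ-LIFTS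
`M_v = v^α + Σ a_j(x) x^{e_j + ε₁(α−j)} v^j`, `M_w` likewise, satisfy `Φ(M_v) = x^{ε₁α} W_v` (`substAlgHom_lift`), so lie in
`P = Φ⁻¹P′`.  With `I′ = (W_v^N, W_w^N) ⊆ P′` and `I = (M_v^N, M_w^N) ⊆ P^N`:

* `exists_pow_mul_sub_subst_mem` (BOUNDED DENOMINATORS): `x^K · G ∈ Φ(R₃) + I′` for every `G` (`K = ε₁αN + ε₂βN`);
* `mem_span_lift_of_subst_mem` (INJECTIVITY MODULO THE WEIERSTRASS IDEALS): `Φ(G) ∈ I′ ⇒ G ∈ I`;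
* `exists_mul_mem_pow_comap` (**MAIN**): if `Φ(F) = x^m · F′` and `F′ ∈ P′^(d)` (`s′F′ ∈ P′^d`, `s′ ∉ P′`) then `F ∈ P^(d)`:
  `t·F ∈ P^d` with `t = x^{K(d+1)}·s ∉ P`.
The Weierstrass elements exist as soon as `dim R₃⧸P′ = 1` (part 4, `…TOT2ChartBranchWeierstrass`).
-/

set_option linter.dupNamespace false -- mandated namespace of this single-conjunct summit

noncomputable section

namespace Summit.ResolutionOfSingularities.ResolutionOfSingularities.Theorems

namespace TOT2Chart

open MvPowerSeries IsLocalRing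

variable {k : Type} [Field k]

/-! ## §1 Weierstrass elements `X s ^ α + Σ_j r_j(x) x^{e_j} (X s)^j` -/

/-- A Weierstrass element is `X s ^ α` modulo `(x)`. -/
theorem X_pow_sub_weierstrass_mem_span (s : Fin 3) {α : ℕ} (r : Fin α → MvPowerSeries (Fin 1) k)
    (hr : ∀ j, constantCoeff (r j) = 0) (e : Fin α → ℕ) :
    X s ^ α - (X s ^ α + ∑ j, rename (fun _ : Fin 1 => (0 : Fin 3)) (r j) * X 0 ^ (e j) * X s ^ (j : ℕ)) ∈
      Ideal.span {(X 0 : MvPowerSeries (Fin 3) k)} := by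
  rw [sub_add_cancel_left, Ideal.neg_mem_iff]
  refine Ideal.sum_mem _ fun j _ => ?_
  obtain ⟨q, hq⟩ := exists_rename_zero_eq_C_add_X_mul (r j)
  rw [hq, hr j, map_zero, zero_add, mul_assoc, mul_assoc]
  exact Ideal.mul_mem_right _ _ (Ideal.mem_span_singleton_self _)

/-- `X s ^ (α N) ∈ J ⊔ (x)` as soon as the `N`-th power of a Weierstrass element of degree `α` in `X s` lies in `J`. -/
theorem X_pow_mul_mem_sup {J : Ideal (MvPowerSeries (Fin 3) k)} (s : Fin 3) {α : ℕ} (r : Fin α → MvPowerSeries (Fin 1) k)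
    (hr : ∀ j, constantCoeff (r j) = 0) (e : Fin α → ℕ) (N : ℕ)
    (hJ : (X s ^ α + ∑ j, rename (fun _ : Fin 1 => (0 : Fin 3)) (r j) * X 0 ^ (e j) * X s ^ (j : ℕ)) ^ N ∈ J) :
    (X s : MvPowerSeries (Fin 3) k) ^ (α * N) ∈ J ⊔ Ideal.span {(X 0 : MvPowerSeries (Fin 3) k)} := by
  rw [pow_mul]
  refine (sup_le_sup_right ((Ideal.span_singleton_le_iff_mem _).mpr hJ) _) (pow_mem_span_pow_sup ?_ N)
  exact X_pow_sub_weierstrass_mem_span s r hr e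

/-- A Weierstrass element in `v = X 1` is the image of a series in `x, v` alone, hence FREE OF `w`: so are its powers. -/
theorem coeff_pow_weierstrass_one_eq_zero {α : ℕ} (r : Fin α → MvPowerSeries (Fin 1) k) (e : Fin α → ℕ) (N : ℕ)
    {E : Fin 3 →₀ ℕ} (hE : E 2 ≠ 0) :
    coeff E ((X 1 ^ α + ∑ j, rename (fun _ : Fin 1 => (0 : Fin 3)) (r j) * X 0 ^ (e j) * X 1 ^ (j : ℕ)) ^ N) = 0 := by
  classical
  set g : MvPowerSeries (Fin 2) k := X 1 ^ α + ∑ j, rename (fun _ : Fin 1 => (0 : Fin 2)) (r j) * X 0 ^ (e j) * X 1 ^ (j : ℕ)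
    with hg
  have hW : (X 1 ^ α + ∑ j, rename (fun _ : Fin 1 => (0 : Fin 3)) (r j) * X 0 ^ (e j) * X 1 ^ (j : ℕ) : MvPowerSeries (Fin 3) k) =
      rename (Fin.castSucc : Fin 2 → Fin 3) g := by
    rw [hg, map_add, map_pow, rename_X, map_sum]
    simp only [map_mul, map_pow, rename_X, rename_rename]
    rfl
  rw [hW, ← map_pow]
  apply coeff_rename_eq_zero
  rintro ⟨u, hu⟩
  apply hE
  rw [← hu]
  exact Finsupp.mapDomain_notin_range _ _ (by rintro ⟨i, hi⟩; fin_cases i <;> exact absurd hi (by decide))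

/-! ## §2 The chart map, the lifts, and the two Weierstrass ideals -/

section Transport

variable {a : Fin 3 → MvPowerSeries (Fin 3) k} (ha : HasSubst a) {ε₁ ε₂ : ℕ}

/-- **THE LIFT IDENTITY** `Φ(M_v) = x^{ε₁ α} · W_v`: the lift has exponents `e_j + ε₁ (α - j)`. -/
theorem substAlgHom_lift_one (h0 : a 0 = X 0) (h1 : a 1 = X 0 ^ ε₁ * X 1) {α : ℕ} (r : Fin α → MvPowerSeries (Fin 1) k)
    (e : Fin α → ℕ) :
    substAlgHom (R := k) ha (X 1 ^ α + ∑ j, rename (fun _ : Fin 1 => (0 : Fin 3)) (r j) * X 0 ^ (e j + ε₁ * (α - j)) * X 1 ^ (j : ℕ)) =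
      X 0 ^ (ε₁ * α) * (X 1 ^ α + ∑ j, rename (fun _ : Fin 1 => (0 : Fin 3)) (r j) * X 0 ^ (e j) * X 1 ^ (j : ℕ)) := by
  rw [map_add, map_pow, substAlgHom_X, h1, map_sum, mul_add, Finset.mul_sum]
  congr 1
  · rw [mul_pow, ← pow_mul]
  · refine Finset.sum_congr rfl fun j _ => ?_
    rw [map_mul, map_mul, map_pow, map_pow, substAlgHom_rename_zero ha h0, substAlgHom_X, substAlgHom_X, h0, h1, mul_pow,
      ← pow_mul]
    have hj : ε₁ * (α - (j : ℕ)) + ε₁ * (j : ℕ) = ε₁ * α := by rw [← mul_add, Nat.sub_add_cancel j.2.le]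
    calc rename (fun _ : Fin 1 => (0 : Fin 3)) (r j) * X 0 ^ (e j + ε₁ * (α - (j : ℕ))) * (X 0 ^ (ε₁ * (j : ℕ)) * X 1 ^ (j : ℕ))
        = rename (fun _ : Fin 1 => (0 : Fin 3)) (r j) * X 0 ^ (e j) * (X 0 ^ (ε₁ * (α - (j : ℕ))) * X 0 ^ (ε₁ * (j : ℕ))) *
            X 1 ^ (j : ℕ) := by rw [pow_add]; ring
      _ = X 0 ^ (ε₁ * α) * (rename (fun _ : Fin 1 => (0 : Fin 3)) (r j) * X 0 ^ (e j) * X 1 ^ (j : ℕ)) := by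
          rw [← pow_add, hj]; ring

/-- The lift identity for `w`: `Φ(M_w) = x^{ε₂ β} · W_w`. -/
theorem substAlgHom_lift_two (h0 : a 0 = X 0) (h2 : a 2 = X 0 ^ ε₂ * X 2) {β : ℕ} (r : Fin β → MvPowerSeries (Fin 1) k)
    (e : Fin β → ℕ) :
    substAlgHom (R := k) ha (X 2 ^ β + ∑ j, rename (fun _ : Fin 1 => (0 : Fin 3)) (r j) * X 0 ^ (e j + ε₂ * (β - j)) * X 2 ^ (j : ℕ)) =
      X 0 ^ (ε₂ * β) * (X 2 ^ β + ∑ j, rename (fun _ : Fin 1 => (0 : Fin 3)) (r j) * X 0 ^ (e j) * X 2 ^ (j : ℕ)) := by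
  rw [map_add, map_pow, substAlgHom_X, h2, map_sum, mul_add, Finset.mul_sum]
  congr 1
  · rw [mul_pow, ← pow_mul]
  · refine Finset.sum_congr rfl fun j _ => ?_
    rw [map_mul, map_mul, map_pow, map_pow, substAlgHom_rename_zero ha h0, substAlgHom_X, substAlgHom_X, h0, h2, mul_pow,
      ← pow_mul]
    have hj : ε₂ * (β - (j : ℕ)) + ε₂ * (j : ℕ) = ε₂ * β := by rw [← mul_add, Nat.sub_add_cancel j.2.le]
    calc rename (fun _ : Fin 1 => (0 : Fin 3)) (r j) * X 0 ^ (e j + ε₂ * (β - (j : ℕ))) * (X 0 ^ (ε₂ * (j : ℕ)) * X 2 ^ (j : ℕ))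
        = rename (fun _ : Fin 1 => (0 : Fin 3)) (r j) * X 0 ^ (e j) * (X 0 ^ (ε₂ * (β - (j : ℕ))) * X 0 ^ (ε₂ * (j : ℕ))) *
            X 2 ^ (j : ℕ) := by rw [pow_add]; ring
      _ = X 0 ^ (ε₂ * β) * (rename (fun _ : Fin 1 => (0 : Fin 3)) (r j) * X 0 ^ (e j) * X 2 ^ (j : ℕ)) := by
          rw [← pow_add, hj]; ring

variable (h0 : a 0 = X 0) (h1 : a 1 = X 0 ^ ε₁ * X 1) (h2 : a 2 = X 0 ^ ε₂ * X 2)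
  {α β : ℕ} {av : Fin α → MvPowerSeries (Fin 1) k} {aw : Fin β → MvPowerSeries (Fin 1) k}
  (hav : ∀ j, constantCoeff (av j) = 0) (haw : ∀ j, constantCoeff (aw j) = 0)
  {ev : Fin α → ℕ} {ew : Fin β → ℕ} {Wv Ww Mv Mw : MvPowerSeries (Fin 3) k}
  (hWv : Wv = X 1 ^ α + ∑ j, rename (fun _ : Fin 1 => (0 : Fin 3)) (av j) * X 0 ^ (ev j) * X 1 ^ (j : ℕ))
  (hWw : Ww = X 2 ^ β + ∑ j, rename (fun _ : Fin 1 => (0 : Fin 3)) (aw j) * X 0 ^ (ew j) * X 2 ^ (j : ℕ))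
  (hMv : Mv = X 1 ^ α + ∑ j, rename (fun _ : Fin 1 => (0 : Fin 3)) (av j) * X 0 ^ (ev j + ε₁ * (α - j)) * X 1 ^ (j : ℕ))
  (hMw : Mw = X 2 ^ β + ∑ j, rename (fun _ : Fin 1 => (0 : Fin 3)) (aw j) * X 0 ^ (ew j + ε₂ * (β - j)) * X 2 ^ (j : ℕ))

include h0 h1 h2 hav haw hWv hWw in
/-- **BOUNDED DENOMINATORS.**  Modulo `I′ = (W_v^N, W_w^N)` every series becomes a Φ-image after multiplication by `x^K`,
`K = ε₁αN + ε₂βN` — provided `I′ ≠ R₃`. -/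
theorem exists_pow_mul_sub_subst_mem (N : ℕ) (hI' : Ideal.span {Wv ^ N, Ww ^ N} ≠ ⊤) (G : MvPowerSeries (Fin 3) k) :
    ∃ H : MvPowerSeries (Fin 3) k,
      X 0 ^ (ε₁ * (α * N) + ε₂ * (β * N)) * G - substAlgHom (R := k) ha H ∈ Ideal.span {Wv ^ N, Ww ^ N} := by
  classical
  have hv : (X 1 : MvPowerSeries (Fin 3) k) ^ (α * N) ∈ Ideal.span {Wv ^ N, Ww ^ N} ⊔ Ideal.span {(X 0 : MvPowerSeries (Fin 3) k)} :=
    X_pow_mul_mem_sup 1 av hav ev N (by rw [← hWv]; exact Ideal.subset_span (by simp))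
  have hw : (X 2 : MvPowerSeries (Fin 3) k) ^ (β * N) ∈ Ideal.span {Wv ^ N, Ww ^ N} ⊔ Ideal.span {(X 0 : MvPowerSeries (Fin 3) k)} :=
    X_pow_mul_mem_sup 2 aw haw ew N (by rw [← hWw]; exact Ideal.subset_span (by simp))
  obtain ⟨c, hc⟩ := exists_boxPoly_sub_mem hI' hv hw G
  set K := ε₁ * (α * N) + ε₂ * (β * N) with hK
  refine ⟨∑ p : Fin (α * N) × Fin (β * N), rename (fun _ : Fin 1 => (0 : Fin 3)) (c p) *
    X 0 ^ (K - ε₁ * (p.1 : ℕ) - ε₂ * (p.2 : ℕ)) * (X 1 ^ (p.1 : ℕ) * X 2 ^ (p.2 : ℕ)), ?_⟩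
  rw [substAlgHom_boxSum ha h0 h1 h2]
  have hsum : ∑ p : Fin (α * N) × Fin (β * N), rename (fun _ : Fin 1 => (0 : Fin 3)) (c p) *
      X 0 ^ (K - ε₁ * (p.1 : ℕ) - ε₂ * (p.2 : ℕ) + ε₁ * (p.1 : ℕ) + ε₂ * (p.2 : ℕ)) * (X 1 ^ (p.1 : ℕ) * X 2 ^ (p.2 : ℕ)) =
      X 0 ^ K * ∑ p : Fin (α * N) × Fin (β * N), rename (fun _ : Fin 1 => (0 : Fin 3)) (c p) * (X 1 ^ (p.1 : ℕ) * X 2 ^ (p.2 : ℕ)) := by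
    rw [Finset.mul_sum]
    refine Finset.sum_congr rfl fun p _ => ?_
    have h1' : ε₁ * (p.1 : ℕ) ≤ ε₁ * (α * N) := Nat.mul_le_mul_left _ p.1.2.le
    have h2' : ε₂ * (p.2 : ℕ) ≤ ε₂ * (β * N) := Nat.mul_le_mul_left _ p.2.2.le
    have : K - ε₁ * (p.1 : ℕ) - ε₂ * (p.2 : ℕ) + ε₁ * (p.1 : ℕ) + ε₂ * (p.2 : ℕ) = K := by omega
    rw [this]; ring
  rw [hsum, ← mul_sub]
  exact Ideal.mul_mem_left _ _ hc

include h0 h1 h2 hWv hWw hMv hMw in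
/-- The lifts pull `I′` back: `Φ(I) ⊆ I′` for `I = (M_v^N, M_w^N)`. -/
theorem map_span_lift_le (N : ℕ) :
    (Ideal.span {Mv ^ N, Mw ^ N}).map (substAlgHom (R := k) ha) ≤ Ideal.span {Wv ^ N, Ww ^ N} := by
  rw [Ideal.map_span, Ideal.span_le]
  rintro _ ⟨y, hy, rfl⟩
  simp only [Set.mem_insert_iff, Set.mem_singleton_iff] at hy
  rcases hy with rfl | rfl
  · rw [map_pow, hMv, substAlgHom_lift_one ha h0 h1, ← hWv, mul_pow]
    exact Ideal.mul_mem_left _ _ (Ideal.subset_span (by simp))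
  · rw [map_pow, hMw, substAlgHom_lift_two ha h0 h2, ← hWw, mul_pow]
    exact Ideal.mul_mem_left _ _ (Ideal.subset_span (by simp))

include h0 h1 h2 hav haw hWv hWw hMv hMw in
/-- **INJECTIVITY MODULO THE WEIERSTRASS IDEALS**: `Φ(G) ∈ (W_v^N, W_w^N) ⇒ G ∈ (M_v^N, M_w^N)`. -/
theorem mem_span_lift_of_subst_mem (N : ℕ) {G : MvPowerSeries (Fin 3) k}
    (hG : substAlgHom (R := k) ha G ∈ Ideal.span {Wv ^ N, Ww ^ N}) : G ∈ Ideal.span {Mv ^ N, Mw ^ N} := by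
  classical
  by_cases hI : Ideal.span {Mv ^ N, Mw ^ N} = ⊤
  · rw [hI]; exact Submodule.mem_top
  -- reduce `G` downstairs modulo `I`
  have hv : (X 1 : MvPowerSeries (Fin 3) k) ^ (α * N) ∈ Ideal.span {Mv ^ N, Mw ^ N} ⊔ Ideal.span {(X 0 : MvPowerSeries (Fin 3) k)} :=
    X_pow_mul_mem_sup 1 av hav (fun j => ev j + ε₁ * (α - j)) N (by rw [← hMv]; exact Ideal.subset_span (by simp))
  have hw : (X 2 : MvPowerSeries (Fin 3) k) ^ (β * N) ∈ Ideal.span {Mv ^ N, Mw ^ N} ⊔ Ideal.span {(X 0 : MvPowerSeries (Fin 3) k)} :=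
    X_pow_mul_mem_sup 2 aw haw (fun j => ew j + ε₂ * (β - j)) N (by rw [← hMw]; exact Ideal.subset_span (by simp))
  obtain ⟨c, hc⟩ := exists_boxPoly_sub_mem hI hv hw G
  set R := ∑ p : Fin (α * N) × Fin (β * N), rename (fun _ : Fin 1 => (0 : Fin 3)) (c p) * (X 1 ^ (p.1 : ℕ) * X 2 ^ (p.2 : ℕ))
    with hR
  -- `Φ R ∈ I′`, and `Φ R` is a box polynomial of `v`-degree `< αN`, `w`-degree `< βN`
  have hΦR : substAlgHom (R := k) ha R ∈ Ideal.span {Wv ^ N, Ww ^ N} := by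
    have h := Ideal.mem_map_of_mem (substAlgHom (R := k) ha) hc
    rw [map_sub] at h
    have h' := map_span_lift_le ha h0 h1 h2 hWv hWw hMv hMw N h
    simpa using Ideal.sub_mem _ hG h'
  have hR' : R = ∑ p : Fin (α * N) × Fin (β * N), rename (fun _ : Fin 1 => (0 : Fin 3)) (c p) * X 0 ^ (0 : ℕ) *
      (X 1 ^ (p.1 : ℕ) * X 2 ^ (p.2 : ℕ)) := by
    simp only [pow_zero, mul_one, hR]
  have hΦR' := hΦR
  rw [hR', substAlgHom_boxSum ha h0 h1 h2] at hΦR'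
  have hzero := eq_zero_of_mem_span_pair (α := α * N) (β := β * N) (Gv := Wv ^ N) (Gw := Ww ^ N)
    (fun E hE => by rw [hWv]; exact coeff_pow_weierstrass_one_eq_zero av ev N hE)
    (fun n hn => by rw [hWv, coeff_single_pow_weierstrass one_ne_zero av hav ev N n, if_neg hn.ne])
    (by rw [hWv, coeff_single_pow_weierstrass one_ne_zero av hav ev N, if_pos rfl]; exact one_ne_zero)
    (fun n hn => by rw [hWw, coeff_single_pow_weierstrass (by decide) aw haw ew N n, if_neg hn.ne])
    (by rw [hWw, coeff_single_pow_weierstrass (by decide) aw haw ew N, if_pos rfl]; exact one_ne_zero)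
    (fun E hE => coeff_boxSum_eq_zero_of_le_fst _ _ _ _ (fun p => p.1.2) hE)
    (fun E hE => coeff_boxSum_eq_zero_of_le_snd _ _ _ _ (fun p => p.2.2) hE) hΦR'
  -- so `Φ R = 0`, `R = 0`, `G ∈ I`
  rw [← substAlgHom_boxSum ha h0 h1 h2, ← hR'] at hzero
  have hR0 : R = 0 := substAlgHom_injective ha h0 h1 h2 (by rw [hzero, map_zero])
  rw [hR0, sub_zero] at hc
  exact hc

include h0 h1 h2 hav haw hWv hWw in
/-- **THE SATURATION STEP.**  For every ideal `J` downstairs: an element of `Φ(J)R₃ + I′`, multiplied by `x^K` and by anything,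
is a Φ-image of an element of `J` modulo `I′`. -/
theorem exists_mem_pow_mul_sub_subst_mem (N : ℕ) (hI' : Ideal.span {Wv ^ N, Ww ^ N} ≠ ⊤) (J : Ideal (MvPowerSeries (Fin 3) k))
    {y : MvPowerSeries (Fin 3) k} (hy : y ∈ J.map (substAlgHom (R := k) ha) ⊔ Ideal.span {Wv ^ N, Ww ^ N})
    (c' : MvPowerSeries (Fin 3) k) :
    ∃ j ∈ J, X 0 ^ (ε₁ * (α * N) + ε₂ * (β * N)) * (c' * y) - substAlgHom (R := k) ha j ∈ Ideal.span {Wv ^ N, Ww ^ N} := by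
  obtain ⟨y₁, hy₁, y₂, hy₂, rfl⟩ := Submodule.mem_sup.mp hy
  suffices h₁ : ∀ c'' : MvPowerSeries (Fin 3) k, ∃ j ∈ J,
      X 0 ^ (ε₁ * (α * N) + ε₂ * (β * N)) * (c'' * y₁) - substAlgHom (R := k) ha j ∈ Ideal.span {Wv ^ N, Ww ^ N} by
    obtain ⟨j, hj, hmem⟩ := h₁ c'
    refine ⟨j, hj, ?_⟩
    have : X 0 ^ (ε₁ * (α * N) + ε₂ * (β * N)) * (c' * (y₁ + y₂)) - substAlgHom (R := k) ha j =
        (X 0 ^ (ε₁ * (α * N) + ε₂ * (β * N)) * (c' * y₁) - substAlgHom (R := k) ha j) +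
          X 0 ^ (ε₁ * (α * N) + ε₂ * (β * N)) * c' * y₂ := by ring
    rw [this]
    exact Ideal.add_mem _ hmem (Ideal.mul_mem_left _ _ hy₂)
  rw [Ideal.map] at hy₁
  refine Submodule.span_induction ?_ ?_ ?_ ?_ hy₁
  · rintro _ ⟨j₀, hj₀, rfl⟩ c''
    obtain ⟨H, hH⟩ := exists_pow_mul_sub_subst_mem ha h0 h1 h2 hav haw hWv hWw N hI' c''
    refine ⟨H * j₀, J.mul_mem_left _ hj₀, ?_⟩
    have : X 0 ^ (ε₁ * (α * N) + ε₂ * (β * N)) * (c'' * substAlgHom (R := k) ha j₀) - substAlgHom (R := k) ha (H * j₀) =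
        (X 0 ^ (ε₁ * (α * N) + ε₂ * (β * N)) * c'' - substAlgHom (R := k) ha H) * substAlgHom (R := k) ha j₀ := by
      rw [map_mul]; ring
    rw [this]
    exact Ideal.mul_mem_right _ _ hH
  · intro c''
    refine ⟨0, J.zero_mem, ?_⟩
    rw [mul_zero, mul_zero, map_zero, sub_zero]
    exact Ideal.zero_mem _
  · intro x y _ _ hx hy c''
    obtain ⟨j₁, hj₁, h₁'⟩ := hx c''
    obtain ⟨j₂, hj₂, h₂'⟩ := hy c''
    refine ⟨j₁ + j₂, J.add_mem hj₁ hj₂, ?_⟩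
    have : X 0 ^ (ε₁ * (α * N) + ε₂ * (β * N)) * (c'' * (x + y)) - substAlgHom (R := k) ha (j₁ + j₂) =
        (X 0 ^ (ε₁ * (α * N) + ε₂ * (β * N)) * (c'' * x) - substAlgHom (R := k) ha j₁) +
          (X 0 ^ (ε₁ * (α * N) + ε₂ * (β * N)) * (c'' * y) - substAlgHom (R := k) ha j₂) := by
      rw [map_add]; ring
    rw [this]
    exact Ideal.add_mem _ h₁' h₂'
  · intro r x _ hx c''
    obtain ⟨j, hj, h⟩ := hx (c'' * r)
    refine ⟨j, hj, ?_⟩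
    have : c'' * (r • x) = c'' * r * x := by rw [smul_eq_mul]; ring
    rwa [this]

include h0 h1 h2 hav haw hWv hWw hMv hMw in
/-- **MAIN THEOREM — SYMBOLIC POWERS DESCEND ALONG `Φ_ε`.**  Let `P′` be a prime of `k⟦x,v,w⟧` not containing `x` and containing the
two Weierstrass elements `W_v`, `W_w`, and let `P = Φ⁻¹(P′)`.  If `Φ(F) = x^m · F′` with `F′` in the symbolic power `P′^(d)`
(`s′F′ ∈ P′^d` for some `s′ ∉ P′`), then `F ∈ P^(d)`: `tF ∈ P^d` for some `t ∉ P`. -/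
theorem exists_mul_mem_pow_comap {P' : Ideal (MvPowerSeries (Fin 3) k)} (hP' : P'.IsPrime)
    (hx : (X 0 : MvPowerSeries (Fin 3) k) ∉ P') (hWvP : Wv ∈ P') (hWwP : Ww ∈ P')
    {F F' : MvPowerSeries (Fin 3) k} {m d : ℕ} (hF : substAlgHom (R := k) ha F = X 0 ^ m * F')
    (hF' : ∃ s', s' ∉ P' ∧ s' * F' ∈ P' ^ d) :
    ∃ t, t ∉ P'.comap (substAlgHom (R := k) ha) ∧ t * F ∈ (P'.comap (substAlgHom (R := k) ha)) ^ d := by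
  classical
  set Φ := substAlgHom (R := k) ha with hΦ
  set P := P'.comap Φ with hP
  haveI : P.IsPrime := Ideal.comap_isPrime Φ P'
  have hxP : (X 0 : MvPowerSeries (Fin 3) k) ∉ P := by
    rw [hP, Ideal.mem_comap, hΦ, substAlgHom_X_zero ha h0]; exact hx
  rcases Nat.eq_zero_or_pos d with rfl | hd
  · exact ⟨1, fun h => ‹P.IsPrime›.ne_top ((Ideal.eq_top_iff_one _).mpr h), by simp⟩
  obtain ⟨s', hs', hs'F'⟩ := hF'
  set N := d with hN
  set K := ε₁ * (α * N) + ε₂ * (β * N) with hK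
  -- the upstairs Weierstrass ideal `I′ ⊆ P′`
  have hI'P : Ideal.span {Wv ^ N, Ww ^ N} ≤ P' := by
    rw [Ideal.span_le]
    rintro _ (rfl | rfl)
    · exact P'.pow_mem_of_mem hWvP N hd
    · exact P'.pow_mem_of_mem hWwP N hd
  have hI' : Ideal.span {Wv ^ N, Ww ^ N} ≠ ⊤ := fun h => hP'.ne_top (top_le_iff.mp (h ▸ hI'P))
  -- the downstairs Weierstrass ideal `I ⊆ P^N`
  have hMvP : Mv ∈ P := by
    rw [hP, Ideal.mem_comap, hΦ, hMv, substAlgHom_lift_one ha h0 h1, ← hWv]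
    exact P'.mul_mem_left _ hWvP
  have hMwP : Mw ∈ P := by
    rw [hP, Ideal.mem_comap, hΦ, hMw, substAlgHom_lift_two ha h0 h2, ← hWw]
    exact P'.mul_mem_left _ hWwP
  have hIP : Ideal.span {Mv ^ N, Mw ^ N} ≤ P ^ N := by
    rw [Ideal.span_le]
    rintro _ (rfl | rfl)
    · exact Ideal.pow_mem_pow hMvP N
    · exact Ideal.pow_mem_pow hMwP N
  -- (i) the multiplier: `x^K s′ = Φ(s) + i′`, `s ∉ P`
  obtain ⟨s, hs⟩ := exists_pow_mul_sub_subst_mem ha h0 h1 h2 hav haw hWv hWw N hI' s'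
  have hsP : s ∉ P := by
    intro hsP
    rw [hP, Ideal.mem_comap] at hsP
    have h1' : X 0 ^ K * s' ∈ P' := by
      have := P'.add_mem (hI'P hs) hsP
      rwa [sub_add_cancel] at this
    rcases hP'.mem_or_mem h1' with h | h
    · exact hx (hP'.mem_of_pow_mem K h)
    · exact hs' h
  -- (ii) `x^K · P′ ⊆ Φ(P)R₃ + I′`, hence `x^{Kd} · P′^d ⊆ Φ(P^d)R₃ + I′`
  have hPle : Ideal.span {(X 0 : MvPowerSeries (Fin 3) k) ^ K} * P' ≤ P.map Φ ⊔ Ideal.span {Wv ^ N, Ww ^ N} := by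
    rw [Ideal.span_singleton_mul_le_iff]
    intro p' hp'
    obtain ⟨q, hq⟩ := exists_pow_mul_sub_subst_mem ha h0 h1 h2 hav haw hWv hWw N hI' p'
    have hqP : q ∈ P := by
      rw [hP, Ideal.mem_comap]
      have : Φ q = X 0 ^ K * p' - (X 0 ^ K * p' - Φ q) := by ring
      rw [this]
      exact P'.sub_mem (P'.mul_mem_left _ hp') (hI'P hq)
    have : X 0 ^ K * p' = Φ q + (X 0 ^ K * p' - Φ q) := by ring
    rw [this]
    exact Submodule.add_mem_sup (Ideal.mem_map_of_mem Φ hqP) hq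
  have hPdle : Ideal.span {(X 0 : MvPowerSeries (Fin 3) k) ^ (K * d)} * P' ^ d ≤ (P ^ d).map Φ ⊔ Ideal.span {Wv ^ N, Ww ^ N} := by
    rw [pow_mul, ← Ideal.span_singleton_pow, ← mul_pow, Ideal.map_pow]
    exact (Ideal.pow_right_mono hPle d).trans (Ideal.sup_pow_le_pow_sup _ _ d)
  -- (iii) `x^{Kd} · Φ(sF) ∈ Φ(P^d)R₃ + I′`
  have hmem : Φ (X 0 ^ (K * d) * (s * F)) ∈ (P ^ d).map Φ ⊔ Ideal.span {Wv ^ N, Ww ^ N} := by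
    have hΦs : Φ s = X 0 ^ K * s' - (X 0 ^ K * s' - Φ s) := by ring
    rw [map_mul, map_mul, map_pow, hΦ, substAlgHom_X_zero ha h0, ← hΦ, hF, hΦs]
    have : X 0 ^ (K * d) * ((X 0 ^ K * s' - (X 0 ^ K * s' - Φ s)) * (X 0 ^ m * F')) =
        X 0 ^ (K + m) * (X 0 ^ (K * d) * (s' * F')) - X 0 ^ (K * d) * X 0 ^ m * F' * (X 0 ^ K * s' - Φ s) := by ring
    rw [this]
    refine Ideal.sub_mem _ (Ideal.mul_mem_left _ _ (hPdle (Ideal.mul_mem_mul (Ideal.mem_span_singleton_self _) hs'F'))) ?_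
    exact Ideal.mem_sup_right (Ideal.mul_mem_left _ _ hs)
  -- (iv) saturate and pull back through the injectivity modulo the Weierstrass ideals
  obtain ⟨j, hj, hjmem⟩ := exists_mem_pow_mul_sub_subst_mem ha h0 h1 h2 hav haw hWv hWw N hI' (P ^ d) hmem 1
  have hjmem' : Φ (X 0 ^ K * (X 0 ^ (K * d) * (s * F)) - j) ∈ Ideal.span {Wv ^ N, Ww ^ N} := by
    rw [map_sub, map_mul, map_pow, hΦ, substAlgHom_X_zero ha h0, ← hΦ]
    simpa only [one_mul] using hjmem
  have hdown := mem_span_lift_of_subst_mem ha h0 h1 h2 hav haw hWv hWw hMv hMw N hjmem'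
  have hfinal : X 0 ^ K * (X 0 ^ (K * d) * (s * F)) ∈ P ^ d := by
    have := (P ^ d).add_mem (hIP hdown) hj
    rwa [sub_add_cancel] at this
  refine ⟨X 0 ^ K * X 0 ^ (K * d) * s, ?_, ?_⟩
  · intro h
    rcases ‹P.IsPrime›.mem_or_mem h with h' | h'
    · rcases ‹P.IsPrime›.mem_or_mem h' with h'' | h''
      · exact hxP (‹P.IsPrime›.mem_of_pow_mem K h'')
      · exact hxP (‹P.IsPrime›.mem_of_pow_mem _ h'')
    · exact hsP h'
  · have : X 0 ^ K * X 0 ^ (K * d) * s * F = X 0 ^ K * (X 0 ^ (K * d) * (s * F)) := by ring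
    rw [this]; exact hfinal

end Transport

end TOT2Chart

end Summit.ResolutionOfSingularities.ResolutionOfSingularities.Theorems

end
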